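import Literature.Geometry.Lorentzian.InteriorKerrGluing
import HarnessLib

/-!
# Short-pulse vacuum data close to the Schwarzschild cylinder inside the black hole (Li–Mei 2020)

J. Li, H. Mei, *A construction of collapsing spacetimes in vacuum*, Comm. Math. Phys. 378 (2020)
1343–1389 = arXiv:2005.01249 [LiMei2020], **Theorem 2.1** (§2.1, arXiv p. 7) together with the
displayed estimate of **§2.2** (arXiv p. 8), vendored as the named fact
`LiMei.shortPulseCylinderData` (D-0014) in the vocabulary of `InteriorKerrGluing.lean`
(`LiMei.IsVacuumOn`, `LiMei.NearSchwarzschildCylinder`), of which it is exactly the INPUT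
("the data `(ḡ, k̄)` induced on `H`").

## The printed statements

* Thm. 2.1 (p. 7): "Let `δ > 0` be a small number, `m₀ > 0`, `u₀ < u₁ < 0` and `k` be a large integer.
  Then there exists an `ε₀ > 0` (only depending on `m₀`), such that if `δ` is sufficiently small,
  the solution `g` of the vacuum Einstein equations exists for `0 ≤ u̲ ≤ δ + ε₀`, `u₀ ≤ u ≤ u₁`. In
  addition, the solution `g` in `δ ≤ u̲ ≤ δ + ε₀`, `u₀ ≤ u ≤ u₁` is `δ^{1/2}`-close to the
  Schwarzschild metric `g_{m₀}` with mass `m₀` also defined in the same region in the `C^k`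
  topology." The data on the initial cone `C_{u₀}` are exactly Minkowskian before the short pulse
  (p. 7), so the spacetime contains a flat region around the centre (their region IV); "the smooth
  solution `g`" (p. 21); "we may set in particular `|u₀| < 2m₀`", so that the near-Schwarzschild
  region lies inside the Schwarzschild black hole (p. 8).
* §2.2 (p. 8): "We first choose a function `Σ⁺_II(u̲)` such that the hypersurface `u = Σ⁺_II(u̲)`,
  `δ ≤ u̲ ≤ δ + ε₀`, is exactly the hypersurface `r_{g_{m₀}} = r₀ < 2m₀` relative to the
  Schwarzschild metric `g_{m₀}`. We denote this hypersurface (excluding its boundary) by `H` and the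
  initial data induced on it by `g` by `(ḡ, k̄)`. A key property of `H` is that the `H` will not
  shrink as `δ → 0` because `ε₀` does not depend on `δ`. The closeness to Schwarzschild metric
  implies that, given large integer `k`,
  `‖ḡ − ḡ_{m₀}‖_{C^k(ḡ_{m₀})} + ‖k̄ − k̄_{m₀}‖_{C^k(ḡ_{m₀})} ≤ C δ^{1/2}`
  if `δ` is sufficiently small, where `(ḡ_{m₀}, k̄_{m₀})` is the initial data of the Schwarzschild
  metric `g_{m₀}` induced on `Σ⁺_II`, and `C` is a constant independent of `δ`." And: "It is then
  easy to extend `Σ⁺_II` inside to obtain `Σ⁺_III` and `Σ⁺_IV`, which are chosen to be in the form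
  `u = f(u̲)` for some decreasing function `f`" (`Σ⁺_IV` lies in the Minkowskian region and closes up
  at the centre; `Σ⁺ = Σ⁺_I ∪ Σ⁺_II ∪ Σ⁺_III ∪ Σ⁺_IV` "is a smooth, complete asymptotically flat
  Cauchy data", so `Σ⁺_IV ∪ Σ⁺_III ∪ H` is a `3`-ball whose outer collar is the cylinder `H`).

Hence (what is vendored): for every mass `M > 0` there are a cylinder radius `0 < r₀ < 2M` and a
length `ℓ > 0` such that for every order `k` and every `ε > 0` there is a SMOOTH VACUUM datum on a
`3`-ball whose collar `≅ (t₁, t₁ + ℓ) × S²` is `ε`-close in `C^k` to the data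
`(ḡ_M, k̄_M) = ((2M/r₀ − 1) dt² + r₀² dΩ², M r₀⁻² (2M/r₀ − 1)^{1/2} dt² − r₀ (2M/r₀ − 1)^{1/2} dΩ²)`
induced on the spacelike cylinder `{r = r₀}` inside the Schwarzschild(`M`) black hole (their (4.1)) —
the undeformed data of `Σ⁺` (take `δ` small; the data of `g` on `Σ⁺_IV ∪ Σ⁺_III ∪ H`).

## Transport to the tree (exactly as in `InteriorKerrGluing.lean`, whose hypothesis this feeds)

* The ball is realised as `{‖y‖ < ρ₁ + ℓ} ⊂ E3` and the collar as the annulus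
  `{ρ₁ < ‖y‖ < ρ₁ + ℓ}`, the cylinder being read through the model map
  `schwCylMap r₀ 0 : y ↦ (t* = ‖y‖, x⃗ = r₀ y/‖y‖)` into the ingoing Kerr–Schild chart
  `Kerr.region 0 r₁` (any `0 < r₁ < r₀`) of Schwarzschild(`M`): on `{r = r₀}`, `t* = t + const`, and
  `∂_{t*}` is a Killing field tangent to the cylinder, so the `t`-range of `H` may be placed at
  `t* ∈ (ρ₁, ρ₁ + ℓ)` for ANY `ρ₁` (we ask `1 ≤ ρ₁` as `NearSchwarzschildCylinder` lives on
  `Kerr.slice 0 1 = {1 < ‖y‖}`); the chart parameter `r₁` is immaterial (the model data do not depend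
  on it). Closeness is the sup-`C^k` Cartesian closeness `NearSchwarzschildCylinder M r₁ r₀ ρ₁ ρ₂ k ε`
  of `InteriorKerrGluing.lean` (on the relatively compact annulus it is dominated by their
  `C^k(ḡ_{m₀})` norm up to a constant depending only on the geometry, so "`≤ C δ^{1/2}`, `δ` small"
  gives every `ε > 0`, one order of differentiability being given up as there).
* The datum is an `InitialDataSet (𝓡 3) E3`: SMOOTH data on all of `E3`, VACUUM ON THE BALL
  (`IsVacuumOn {‖y‖ < ρ₁ + ℓ}`: the data are induced by the smooth vacuum solution `g` on the smooth
  spacelike hypersurface `Σ⁺_IV ∪ Σ⁺_III ∪ H`, Gauss–Codazzi) and unconstrained beyond the ball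
  (any smooth extension, e.g. by a cutoff towards the flat data; `InteriorKerrGluing` never reads it).
* The length `ℓ` is a fixed sub-length of the `t`-extent of `H`, which is positive uniformly in `δ`
  ("`H` will not shrink as `δ → 0`"); `r₀` is the radius of their cylinder, `0 < r₀ < |u₀| < 2M`.

## Specialisation / regularity (recorded honestly)

* Special case of the print: only the restriction of the undeformed data to the ball
  `Σ⁺_IV ∪ Σ⁺_III ∪ H` is kept, transported to `E3` as above; the quantitative rate `C δ^{1/2}`, the
  flatness of the core `Σ⁺_IV` and everything about the spacetime `g` itself are NOT recorded.
* Regularity: Li–Mei's `g` is smooth (p. 21: "the smooth solution `g` of the vacuum Einstein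
  equations exists"), so the induced data are smooth; the closeness is asked for one arbitrary finite
  order `k` at a time, as printed ("given large integer `k`").
* NOT stated: Theorem 2.2 / Prop. 4.1 (that is `LiMei.interiorKerrGluing`), Theorems 2.3–2.4, the
  Main Theorem (isolated non-black-hole data), any symmetry of the datum.
* Li–Mei note (p. 8) that Thm. 2.1 "can in fact be found in" Li–Yu, Ann. Math. 181 (2015)
  [LiYu2015], whose proof rests on Christodoulou's short-pulse method [Christodoulou2008].
-/

noncomputable section

open Bundle Set TopologicalSpace
open scoped Manifold ContDiff Topology

namespace Literature.Geometry.Lorentzian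

namespace LiMei

/-- **Short-pulse vacuum data close to the Schwarzschild cylinder** — J. Li, H. Mei, Comm. Math.
Phys. 378 (2020) = arXiv:2005.01249, **Thm. 2.1** (§2.1, p. 7: the smooth vacuum short-pulse
spacetime, flat before the pulse, `δ^{1/2}`-close in `C^k` to Schwarzschild(`m₀`) after it, inside the
black hole since `|u₀| < 2m₀`) **with the displayed estimate of §2.2** (p. 8: the data `(ḡ, k̄)`
induced by `g` on the cylinder `H = {r_{g_{m₀}} = r₀ < 2m₀}`, which "will not shrink as `δ → 0`",
satisfy `‖ḡ − ḡ_{m₀}‖_{C^k} + ‖k̄ − k̄_{m₀}‖_{C^k} ≤ C δ^{1/2}`, and `H` extends inside through the pulse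
and the flat region to the `3`-ball `Σ⁺_IV ∪ Σ⁺_III ∪ H`), transported to `E3` (module docstring):
for every mass `M > 0` there are a cylinder radius `0 < r₀ < 2M` and a length `ℓ > 0` such that, for
every chart parameter `0 < r₁ < r₀`, every placement `1 ≤ ρ₁` of the collar, every order `k` and
every `ε > 0`, there is a smooth datum on `E3` which solves the vacuum constraints on the ball
`{‖y‖ < ρ₁ + ℓ}` and is `ε`-close in sup-`C^k` on the annulus `{ρ₁ < ‖y‖ < ρ₁ + ℓ}` to the
Schwarzschild(`M`) cylinder `{r = r₀}` (`NearSchwarzschildCylinder`, the hypothesis of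
`LiMei.interiorKerrGluing`). Named fact (D-0014); theorem in print (the a-priori estimates of their
§6, after Christodoulou 2008 / Li–Yu 2015). [cite: LiMei2020, Thm. 2.1 and §2.2] -/
def shortPulseCylinderData : Prop :=
  ∀ [Kerr.Facts], ∀ M : ℝ, 0 < M →
    ∃ (r₀ ℓ : ℝ), 0 < r₀ ∧ r₀ < 2 * M ∧ 0 < ℓ ∧
      ∀ (r₁ ρ₁ : ℝ), 0 < r₁ → r₁ < r₀ → 1 ≤ ρ₁ →
        ∀ (k : ℕ) (ε : ℝ), 0 < ε →
          ∃ D : InitialDataSet (𝓡 3) E3,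
            IsVacuumOn {y : E3 | ‖y‖ < ρ₁ + ℓ} D ∧
            NearSchwarzschildCylinder M r₁ r₀ ρ₁ (ρ₁ + ℓ) k ε D
  -- TODO(general form): the spacetime `g` of Thm. 2.1 on `0 ≤ u̲ ≤ δ + ε₀`, `u₀ ≤ u ≤ u₁`, its
  -- `δ^{1/2}`-closeness to `g_{m₀}` in `C^k`, the rate `C δ^{1/2}` for `(ḡ, k̄)` and the flat core.

/-! ### Sanity: the geometric side conditions are jointly satisfiable -/

/-- The numerical side conditions of `shortPulseCylinderData` are consistent: for `M > 0` the
choices `r₀ = M`, `ℓ = 1`, `r₁ = M/2`, `ρ₁ = 1` satisfy `0 < r₀ < 2M`, `0 < ℓ`, `0 < r₁ < r₀`,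
`1 ≤ ρ₁` (anti-vacuity of the quantifier prefix; the content is the existence of `D`). [folklore] -/
theorem shortPulseCylinderData_prefix_consistent {M : ℝ} (hM : 0 < M) :
    ∃ (r₀ ℓ r₁ ρ₁ : ℝ), 0 < r₀ ∧ r₀ < 2 * M ∧ 0 < ℓ ∧ 0 < r₁ ∧ r₁ < r₀ ∧ 1 ≤ ρ₁ :=
  ⟨M, 1, M / 2, 1, hM, by linarith, one_pos, by positivity, by linarith, le_rfl⟩

end LiMei

end Literature.Geometry.Lorentzian

end
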